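import Summits.QuantumFields.BalabanUV.Beta.FP.PeriodisedSymBorderWardContactTwo
import Summits.QuantumFields.BalabanUV.Beta.FP.PeriodisedSymCoarseWardContact

/-!
# `BalabanUV.Beta.FP.PeriodisedSymCoarseWardContactTwo` — road «FP», ROUTE T, binder row D1: **ROW `d2` OF THE (STEP) DOOR AT THE TORUS, BY TERM — WITH THE
# AVERAGE MAP's SECOND-JET MEMBER ON THE GENERATOR SIDE**

The ORDER-2 COARSE covariance row of U21 `NestedStepLawTorusTransportedRowsGradedLevelZeroSymULowClosedLamW2Q2` (:314, a DISPLAYED binder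
`d2 : Q₂₂ h h * Dbar + 2 • (Q₂₁ h * Db₁) + Q₂₀ * Db₂ = 0`) computed from the objects of record, one level up of `PeriodisedSymBorderWardContactTwoInstance`
(row `c2`, which pins `Db₂((p̄,m),t̄) = c_j³·((Q₁₀ h)(p̄,m))²·[t̄ = p̄ + e_m]`).  LOCATED FINDING (kernel-checked here, [folklore] algebra of OUR typed objects; nothing
of the dictionary asserted): with U21's `hQ₂₂` (bi-member along `w̄ = θ·Q₁₀ h` PLUS the average map's second-jet member `θ·((Q₁₁ h)·h) a′ • Q₂₁^{a′}`), `hQ₂₁`, `hDbar`,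
`hDb₁` and that `Db₂`, the row's left-hand side is NOT zero but
**`Q₂₂ h h * Dbar + 2 • (Q₂₁ h * Db₁) + Q₂₀ * Db₂ = Q₂₀ * Db₂′`, `Db₂′((p̄,m), t̄) := c_j·((Q₁₁ h)·h)(p̄,m)·[t̄ = p̄ + e_m]`** (`torus_d2_sym_weighted`) —
the generator-side companion of the second-jet member; the displayed `d2` holds iff `Q₂₀ * Db₂′ = 0`.  (The tip terms cancel `2 • (Q₂₁ h * Db₁)` by
`θ_j·s_j·#B·c_{j+1} = c_j`; the diagonal cancels `Q₂₀ * Db₂` by `#B = Lc⁴`; the far-root terms do not meet the residual columns.)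

WHAT ([folklore] finite sums BY NAME over `PeriodisedSymBorderWardContactTwo.submatrix_borderT2per_mul_tgrad` at `M := M′` and the c1∕d1 coarse plumbing
`PeriodisedSymCoarseWardContact.coarse_symVhSAt_mul_Dbar_apply`, `PeriodisedCoarseWardContact.eq_mul_div`, `tdelta_far_eq_zero_of_not_root`,
`perZ_bhKStepSh_inr_inl_of_proj_ne`): §1 **`coarse_symQ22_mul_Dbar_apply`** (per ordered pair of coarse torus bonds, ANY multiplier presentation `pμ′ mμ′`,
residual columns), §2 **`d2_entry_algebra`**, §3 **`torus_d2_sym_weighted`** (any bond weight `h`, level `j`; `Q₁₀`, `Q₁₁` FREE — the row only sees the weights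
`θ·(Q₁₀ h)` and `θ·((Q₁₁ h)·h)`).  No `def`, no `def … : Prop`, nothing cited, 0 sorry.

HONEST DEPENDENCY (page 1, mandatory): continuum YM on T⁴ ⇐ BetaPertH ∧ nine spine estimates (0/9 proved); BetaPertH ⇐ (D1) ∧ (D4) ∧ CAP+tail;
G-an2-4 gates asym, D1 and NE2/3/4.  HONEST FRAMING (cell contract, verbatim): «discharging `BetaPertH` makes Bałaban's UV stability UNCONDITIONAL —
a real constructive-QFT result; it is NOT the continuum limit and NOT the Clay problem.»  ABSOLUTE RULE (cell charter, verbatim): «No internally-minted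
statement may enter as a cited fact. Every hypothesis is either kernel-proved in this package or a verbatim quotation of a PUBLISHED theorem with page
reference. The manuscript(s) under audit are NOT citable for their own disputed steps — they are the thing under adjudication; programme-internal
(2001/route/tribunal) claims are never citable.»  0 estimates; 0∕4 row-D1 binders (hW, hR, D1Tel, D1Rep); NOT (T-ID), NOT (J-a) complete, NOT SDF, NOT D1,
NOT BetaPertH, NOT continuum, NOT Clay.  D1 formalisation swarm LEAF PROVER 02 (b2b-balaban-beta-d1-formalise-leaf-02 gen 23), 2026-08-23.  No existing file touched.
-/

noncomputable section

open scoped BigOperators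

namespace Summit.QuantumFields.BalabanUV.Beta.FP.PeriodisedSymCoarseWardContactTwo

open Finset Matrix
open Literature.Probability.LatticeModels (Torus.proj)
open Literature.MathematicalPhysics.QuantumFieldTheory.Balaban1983to89
open Literature.MathematicalPhysics.QuantumFieldTheory.Balaban1983to89.Beta
open B4TorusKernel.MultiPeriod (translate)
open B5Prop11Plancherel (fine)
open B6Lemma24Torus (pbox)
open ExpKernelCalculus (MKer)
open AffineAveraging (Site box toSite unitVec)
open AveragingContoursRooted (ctr ctrOff ctrOff_mem_box)
open OneStepResolventKernel (Fib)
open Summit.QuantumFields.BalabanUV.Beta.BorderedHessian (stepScale stepScale_ne_zero)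
open Summit.QuantumFields.BalabanUV.Beta.DshAn1 (Dsh)
open Summit.QuantumFields.BalabanUV.Beta.SymAveragingHessianCounts (symVhSAt)
open Summit.QuantumFields.BalabanUV.Beta.SymShiftedSpread (bhKStepSh)
open Summit.QuantumFields.BalabanUV.Beta.SymSecondOrderTablesAn1 (symVh₂SAn1)
open Summit.QuantumFields.BalabanUV.Beta.FP.KernelPeriodisationFib (Idx perF perF_apply)
open Summit.QuantumFields.BalabanUV.Beta.FP.KernelPeriodisationFibLoc (dper)
open Summit.QuantumFields.BalabanUV.Beta.FP.TorusGaugeCovariance (tdelta tgrad)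
open Summit.QuantumFields.BalabanUV.Beta.FP.TorusCombRows (Res ne_rootOf_iff_proj_ne)
open Summit.QuantumFields.BalabanUV.Beta.GAN24.FineReadoutCauchyFrame (toSite_mem_range)
open Summit.QuantumFields.BalabanUV.Beta.FP.PeriodisedBorderWardContact (tdelta_far_eq_zero_of_not_root)
open Summit.QuantumFields.BalabanUV.Beta.FP.PeriodisedSymBorderWardContact (perZ_bhKStepSh_inr_inl_of_proj_ne)
open Summit.QuantumFields.BalabanUV.Beta.FP.PeriodisedCoarseWardContact (eq_mul_div)
open Summit.QuantumFields.BalabanUV.Beta.FP.PeriodisedSymCoarseWardContact (coarse_symVhSAt_mul_Dbar_apply)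
open Summit.QuantumFields.BalabanUV.Beta.FP.PeriodisedSymBorderWardContactTwo (submatrix_borderT2per_mul_tgrad)

variable (M' : Fin (3 + 1) → ℕ) [∀ μ, NeZero (M' μ)] {Lc : ℕ} [NeZero Lc]

/-! ## §1 The per-pair block of `Q₂₂^{a′,a″} · D̄` (coarse level, any multiplier presentation, residual columns) -/

omit [∀ μ, NeZero (M' μ)] [NeZero Lc] in
/-- [folklore] two coarse torus bonds are equal iff their (direction, site) pairs are. -/
theorem ite_bond_eq (b b' : ↥(pbox M') × Fin (3 + 1)) :
    (if (b.2, (b.1 : Site (3 + 1))) = (b'.2, (b'.1 : Site (3 + 1))) then (1 : ℝ) else 0) = if b = b' then (1 : ℝ) else 0 := by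
  by_cases hb : b = b'
  · subst hb; rw [if_pos rfl, if_pos rfl]
  · rw [if_neg hb, if_neg fun e => hb ?_]
    obtain ⟨h2, h1⟩ := Prod.mk.inj e
    exact Prod.ext (Subtype.ext h1) h2

/-- [folklore] **`coarse_symQ22_mul_Dbar_apply` — THE PER-PAIR BLOCK OF `Q₂₂^{a′,a″} · D̄`** (`Lc ∣ M′`; multiplier rows `α ↦ (pμ′ α, inr (mμ′ α))`, ANY
presentation; `D̄ = s_j·#B·tgrad M′↾Res` — U21's `hDbar`; level-`(j+1)` one-step rows `Q₂₀` — U21's `hQ₂₀`): with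
`Q₂₂^{a′,a″} := (perF M′ (dper M′ (W a″.2 ↑a″.1 a′.2 ↑a′.1))).submatrix …` (U21's `hW₂₂`) and `Q₂₁^{a′} := perF M′ (dper M′ (symVhSAt ρ_c 3 Lc rfl a′.2 ↑a′.1))`,
`(Q₂₂^{a′,a″}·D̄)(α, t̄) = s_j·#B·( −( [t̄ = tip a″]·Q₂₁^{a′}(α,a″) + [t̄ = tip a′]·Q₂₁^{a″}(α,a′) − [t̄ = tip a′]·[a′ = a″]·c_{j+1}·Q₂₀(α,a′) ) )`
(the far-root term does not meet a residual column: either `pμ′ α` is a block root and `tdelta_far_eq_zero_of_not_root`, or it is not and its averaging row vanishes). -/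
theorem coarse_symQ22_mul_Dbar_apply (hM' : ∀ i, Lc ∣ M' i) (j : ℕ) {κI : Type*} (pμ' : κI → ↥(pbox M')) (mμ' : κI → Fin (3 + 1))
    {W : Fin (3 + 1) → Site (3 + 1) → Fin (3 + 1) → Site (3 + 1) → MKer (3 + 1) (Fib 3)}
    (hW : W = fun κ' u' κ u x z a c => ∑' n : Site (3 + 1), symVh₂SAn1 3 Lc κ u κ' (translate M' u' n) x z a c)
    {Q₂₀ : Matrix κI (↥(pbox M') × Fin (3 + 1)) ℝ}
    (hQ₂₀ : Q₂₀ = (perF M' (bhKStepSh 3 Lc (Dsh Lc) (j + 1))).submatrix (fun a : κI => ((pμ' a, Sum.inr (mμ' a)) : Idx M' (Fib 3)))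
        (fun b : ↥(pbox M') × Fin (3 + 1) => ((b.1, Sum.inl b.2) : Idx M' (Fib 3))))
    {Dbar : Matrix (↥(pbox M') × Fin (3 + 1)) (Res (ctr (3 + 1) Lc) Lc M') ℝ}
    (hDbar : Dbar = Matrix.of fun (a : ↥(pbox M') × Fin (3 + 1)) (t : Res (ctr (3 + 1) Lc) Lc M') =>
        stepScale 3 Lc j * (((box (3 + 1) Lc).card : ℝ) * tgrad M' (a.1, Sum.inl a.2) t.1))
    (a' a'' : ↥(pbox M') × Fin (3 + 1)) (α : κI) (t : Res (ctr (3 + 1) Lc) Lc M') :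
    ((perF M' (dper M' (W a''.2 (a''.1 : Site (3 + 1)) a'.2 (a'.1 : Site (3 + 1))))).submatrix (fun a : κI => ((pμ' a, Sum.inr (mμ' a)) : Idx M' (Fib 3)))
          (fun b : ↥(pbox M') × Fin (3 + 1) => ((b.1, Sum.inl b.2) : Idx M' (Fib 3))) * Dbar) α t
      = stepScale 3 Lc j * ((box (3 + 1) Lc).card : ℝ)
          * -(tdelta M' ((a''.1 : Site (3 + 1)) + unitVec a''.2) t.1
                * perF M' (dper M' (symVhSAt (ctr (3 + 1) Lc) 3 Lc rfl a'.2 (a'.1 : Site (3 + 1)))) (pμ' α, Sum.inr (mμ' α)) (a''.1, Sum.inl a''.2)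
              + tdelta M' ((a'.1 : Site (3 + 1)) + unitVec a'.2) t.1
                * perF M' (dper M' (symVhSAt (ctr (3 + 1) Lc) 3 Lc rfl a''.2 (a''.1 : Site (3 + 1)))) (pμ' α, Sum.inr (mμ' α)) (a'.1, Sum.inl a'.2)
              - tdelta M' ((a'.1 : Site (3 + 1)) + unitVec a'.2) t.1 * ((if a' = a'' then (1 : ℝ) else 0) * ((((Lc : ℝ) ^ (3 + 1) * stepScale 3 Lc (j + 1))⁻¹) * Q₂₀ α a'))) := by
  have hLc : 0 < Lc := Nat.pos_of_ne_zero (NeZero.ne Lc)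
  have hLc1 : 1 ≤ Lc := hLc
  have hV : W a''.2 (a''.1 : Site (3 + 1)) = fun κ u x z a c => ∑' n : Site (3 + 1), symVh₂SAn1 3 Lc κ u a''.2 (translate M' (a''.1 : Site (3 + 1)) n) x z a c := by
    subst hW; rfl
  -- the per-pair identity of the fine file, read at `M := M′` against the plain `tgrad` columns on the residual parameters
  have key : ((perF M' (dper M' (W a''.2 (a''.1 : Site (3 + 1)) a'.2 (a'.1 : Site (3 + 1))))).submatrix (fun a : κI => ((pμ' a, Sum.inr (mμ' a)) : Idx M' (Fib 3)))
          (fun b : ↥(pbox M') × Fin (3 + 1) => ((b.1, Sum.inl b.2) : Idx M' (Fib 3)))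
        * (tgrad M').submatrix (fun b : ↥(pbox M') × Fin (3 + 1) => ((b.1, Sum.inl b.2) : Idx M' (Fib 3)))
            (Subtype.val : Res (ctr (3 + 1) Lc) Lc M' → ↥(pbox M'))) α t
      = -(tdelta M' ((a''.1 : Site (3 + 1)) + unitVec a''.2) t.1
            * perF M' (dper M' (symVhSAt (ctr (3 + 1) Lc) 3 Lc rfl a'.2 (a'.1 : Site (3 + 1)))) (pμ' α, Sum.inr (mμ' α)) (a''.1, Sum.inl a''.2)
          + tdelta M' ((a'.1 : Site (3 + 1)) + unitVec a'.2) t.1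
            * perF M' (dper M' (symVhSAt (ctr (3 + 1) Lc) 3 Lc rfl a''.2 (a''.1 : Site (3 + 1)))) (pμ' α, Sum.inr (mμ' α)) (a'.1, Sum.inl a'.2)
          - tdelta M' ((a'.1 : Site (3 + 1)) + unitVec a'.2) t.1 * ((if a' = a'' then (1 : ℝ) else 0)
              * ((((Lc : ℝ) ^ (3 + 1) * stepScale 3 Lc (j + 1))⁻¹) * perF M' (bhKStepSh 3 Lc (Dsh Lc) (j + 1)) (pμ' α, Sum.inr (mμ' α)) (a'.1, Sum.inl a'.2)))
          + tdelta M' ((pμ' α : Site (3 + 1)) + ctr (3 + 1) Lc + (Lc : ℤ) • unitVec (mμ' α)) t.1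
              * (((((Lc : ℝ) ^ (3 + 1) * stepScale 3 Lc (j + 1))⁻¹) * perF M' (bhKStepSh 3 Lc (Dsh Lc) (j + 1)) (pμ' α, Sum.inr (mμ' α)) (a'.1, Sum.inl a'.2))
                * ((((Lc : ℝ) ^ (3 + 1) * stepScale 3 Lc (j + 1))⁻¹) * perF M' (bhKStepSh 3 Lc (Dsh Lc) (j + 1)) (pμ' α, Sum.inr (mμ' α)) (a''.1, Sum.inl a''.2)))) := by
    have h := submatrix_borderT2per_mul_tgrad a''.2 (a''.1 : Site (3 + 1)) (M := M') (M' := fun i => M' i / Lc) (eq_mul_div M' hM') hV a''.1.2 (j + 1)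
      (fun a : κI => ((pμ' a : ↥(pbox M')) : Site (3 + 1))) (fun a => (pμ' a).2) mμ' (Subtype.val : Res (ctr (3 + 1) Lc) Lc M' → ↥(pbox M')) a'.2 a'.1 α t
    rw [ite_bond_eq] at h
    exact h
  -- `D̄` is the scalar `s_j·#B` times those columns
  have hentry : ∀ x : ↥(pbox M') × Fin (3 + 1),
      (perF M' (dper M' (W a''.2 (a''.1 : Site (3 + 1)) a'.2 (a'.1 : Site (3 + 1))))).submatrix (fun a : κI => ((pμ' a, Sum.inr (mμ' a)) : Idx M' (Fib 3)))
          (fun b : ↥(pbox M') × Fin (3 + 1) => ((b.1, Sum.inl b.2) : Idx M' (Fib 3))) α x * Dbar x t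
        = (stepScale 3 Lc j * ((box (3 + 1) Lc).card : ℝ))
          * ((perF M' (dper M' (W a''.2 (a''.1 : Site (3 + 1)) a'.2 (a'.1 : Site (3 + 1))))).submatrix (fun a : κI => ((pμ' a, Sum.inr (mμ' a)) : Idx M' (Fib 3)))
              (fun b : ↥(pbox M') × Fin (3 + 1) => ((b.1, Sum.inl b.2) : Idx M' (Fib 3))) α x
            * (tgrad M').submatrix (fun b : ↥(pbox M') × Fin (3 + 1) => ((b.1, Sum.inl b.2) : Idx M' (Fib 3)))
                (Subtype.val : Res (ctr (3 + 1) Lc) Lc M' → ↥(pbox M')) x t) := fun x => by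
    rw [hDbar]
    simp only [Matrix.of_apply, Matrix.submatrix_apply]
    ring
  rw [Matrix.mul_apply] at key
  rw [Matrix.mul_apply, Finset.sum_congr rfl fun x _ => hentry x, ← Finset.mul_sum, key, hQ₂₀]
  simp only [Matrix.submatrix_apply]
  -- the far-root term does not meet the residual column `t`
  have hs : Torus.proj Lc (((t.1 : ↥(pbox M')) : Site (3 + 1)) - ctr (3 + 1) Lc) ≠ 0 :=
    (ne_rootOf_iff_proj_ne hLc (toSite_mem_range (ctrOff_mem_box hLc1)) t.site).1 t.not_root
  by_cases hx : Torus.proj Lc ((pμ' α : ↥(pbox M')) : Site (3 + 1)) = 0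
  · rw [tdelta_far_eq_zero_of_not_root hM' (ctr (3 + 1) Lc) hx (mμ' α) hs]
    ring
  · simp only [perF_apply, perZ_bhKStepSh_inr_inl_of_proj_ne (M := M') (j + 1) hx]
    ring

/-! ## §2 The finite algebra of row `d2` -/

/-- [folklore] **the finite algebra of row `d2`**: the `a′ ↔ a″`-symmetric tip terms of the bi-member cancel `2 • (Q₂₁ h * Db₁)` (scalar `θ_j·s_j·#B·c_{j+1} = c_j`), the
diagonal cancels `Q₂₀ * Db₂` (`#B = Lc⁴`), and the average map's second-jet member survives as `c_j·((Q₁₁ h)·h)`. -/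
theorem d2_entry_algebra {β γ : Type*} [Fintype β] [DecidableEq β] [Fintype γ] (h : γ → ℝ) (Q R : β → γ → ℝ) (P : β → β → ℝ)
    (q τ : β → ℝ) {s₀ s₁ L4 B : ℝ} (hs₀ : s₀ ≠ 0) (hs₁ : s₁ ≠ 0) (hL : L4 ≠ 0) (hB : B = L4) :
    -(L4 * s₁)⁻¹ * (∑ a', ∑ a'', (s₁ / (s₀ ^ 2 * B) * ∑ b, Q a' b * h b) * (s₁ / (s₀ ^ 2 * B) * ∑ b, Q a'' b * h b)
            * (s₀ * B * -(τ a'' * P a' a'' + τ a' * P a'' a' - τ a' * ((if a' = a'' then (1 : ℝ) else 0) * ((L4 * s₁)⁻¹ * q a')))))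
          + ∑ a', (s₁ / (s₀ ^ 2 * B) * ∑ b', R a' b' * h b') * (s₀ * B * (τ a' * ((L4 * s₁)⁻¹ * q a')))
        + 2 * ∑ a, (∑ b, h b * ∑ a', s₁ / (s₀ ^ 2 * B) * Q a' b * P a' a) * (∑ b, h b * -((L4 * s₀)⁻¹ * Q a b * τ a))
        + ∑ a, q a * ((L4 * s₀)⁻¹ ^ 3 * (∑ b, Q a b * h b) ^ 2 * τ a)
      = ∑ a, q a * ((L4 * s₀)⁻¹ * (∑ b', R a b' * h b') * τ a) := by
  rw [hB]
  set K₀ : ℝ := (L4 * s₀)⁻¹ with hK₀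
  set K₁ : ℝ := (L4 * s₁)⁻¹ with hK₁
  set θ : ℝ := s₁ / (s₀ ^ 2 * L4) with hθ
  set S : β → ℝ := fun a => ∑ b, Q a b * h b with hS
  set V : β → ℝ := fun a => ∑ b', R a b' * h b' with hV
  have e0 : ∀ a', (θ * ∑ b, Q a' b * h b) = θ * S a' := fun a' => rfl
  have eV : ∀ a', (θ * ∑ b', R a' b' * h b') = θ * V a' := fun a' => rfl
  have e1 : ∑ a', ∑ a'', (θ * S a') * (θ * S a'')
        * (s₀ * L4 * -(τ a'' * P a' a'' + τ a' * P a'' a' - τ a' * ((if a' = a'' then (1 : ℝ) else 0) * (K₁ * q a'))))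
      = -(θ ^ 2 * (s₀ * L4)) * (∑ a', ∑ a'', S a' * S a'' * (τ a'' * P a' a''))
        - (θ ^ 2 * (s₀ * L4)) * (∑ a', ∑ a'', S a' * S a'' * (τ a' * P a'' a'))
        + (θ ^ 2 * (s₀ * L4) * K₁) * ∑ a', S a' ^ 2 * (τ a' * q a') := by
    have hd : ∀ a', ∑ a'', S a' * S a'' * (τ a' * ((if a' = a'' then (1 : ℝ) else 0) * (K₁ * q a'))) = K₁ * (S a' ^ 2 * (τ a' * q a')) :=
      fun a' => by
      rw [Finset.sum_eq_single a' (fun a'' _ h'' => by rw [if_neg (Ne.symm h'')]; ring) (fun h' => absurd (Finset.mem_univ a') h'), if_pos rfl]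
      ring
    have hre : ∀ a' a'', (θ * S a') * (θ * S a'')
        * (s₀ * L4 * -(τ a'' * P a' a'' + τ a' * P a'' a' - τ a' * ((if a' = a'' then (1 : ℝ) else 0) * (K₁ * q a'))))
        = -(θ ^ 2 * (s₀ * L4)) * (S a' * S a'' * (τ a'' * P a' a'')) - (θ ^ 2 * (s₀ * L4)) * (S a' * S a'' * (τ a' * P a'' a'))
          + (θ ^ 2 * (s₀ * L4)) * (S a' * S a'' * (τ a' * ((if a' = a'' then (1 : ℝ) else 0) * (K₁ * q a')))) := fun a' a'' => by ring
    simp only [hre, Finset.sum_add_distrib, Finset.sum_sub_distrib, ← Finset.mul_sum, hd]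
    ring
  have e2 : ∑ a', ∑ a'', S a' * S a'' * (τ a' * P a'' a') = ∑ a', ∑ a'', S a' * S a'' * (τ a'' * P a' a'') := by
    rw [Finset.sum_comm]
    exact Finset.sum_congr rfl fun _ _ => Finset.sum_congr rfl fun _ _ => by ring
  have e3 : ∑ a, (∑ b, h b * ∑ a', θ * Q a' b * P a' a) * (∑ b, h b * -(K₀ * Q a b * τ a))
      = -(K₀ * θ) * ∑ a', ∑ a'', S a' * S a'' * (τ a'' * P a' a'') := by
    have hin : ∀ a, (∑ b, h b * ∑ a', θ * Q a' b * P a' a) = θ * ∑ a', S a' * P a' a := fun a => by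
      simp only [hS, Finset.mul_sum, Finset.sum_mul]
      rw [Finset.sum_comm]
      exact Finset.sum_congr rfl fun _ _ => Finset.sum_congr rfl fun _ _ => by ring
    have hout : ∀ a, (∑ b, h b * -(K₀ * Q a b * τ a)) = -K₀ * (S a * τ a) := fun a => by
      simp only [hS, Finset.mul_sum, Finset.sum_mul]
      exact Finset.sum_congr rfl fun _ _ => by ring
    simp only [hin, hout]
    rw [Finset.sum_comm, Finset.mul_sum]
    refine Finset.sum_congr rfl fun a' _ => ?_
    rw [Finset.mul_sum, Finset.sum_mul, Finset.mul_sum]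
    exact Finset.sum_congr rfl fun a _ => by ring
  have e4 : ∑ a, q a * (K₀ ^ 3 * (∑ b, Q a b * h b) ^ 2 * τ a) = K₀ ^ 3 * ∑ a', S a' ^ 2 * (τ a' * q a') := by
    rw [Finset.mul_sum]; exact Finset.sum_congr rfl fun a _ => by simp only [hS]; ring
  have e5 : ∑ a', (θ * V a') * (s₀ * L4 * (τ a' * (K₁ * q a'))) = (θ * (s₀ * L4) * K₁) * ∑ a, q a * (V a * τ a) := by
    rw [Finset.mul_sum]; exact Finset.sum_congr rfl fun a _ => by ring
  have e6 : ∑ a, q a * (K₀ * (∑ b', R a b' * h b') * τ a) = K₀ * ∑ a, q a * (V a * τ a) := by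
    rw [Finset.mul_sum]; exact Finset.sum_congr rfl fun a _ => by simp only [hV]; ring
  simp only [e0, eV]
  rw [e1, e2, e3, e4, e5, e6, hK₀, hK₁, hθ]
  field_simp
  ring

/-! ## §3 Row `d2` of the (STEP) door at the torus, any bond weight: the generator-side companion survives -/

/-- [folklore] **`torus_d2_sym_weighted` — ROW `d2` OF U21 AT THE (III′) TORUS CALL, BY TERM, FOR ANY BOND WEIGHT `h`** (level `j`; `Lc ∣ M′`; ANY multiplier
presentation `pμ′ mμ′`; `c_j = (Lc⁴·s_j)⁻¹`, `θ_j = s_{j+1}∕(s_j²·#B)`; `Q₁₀ Q₁₁` FREE): with U21's `hQ₂₀ hQ₂₁ hW₂₂ hQ₂₂ hDbar hDb₁` verbatim (level `j`) and row `c2`'s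
`Db₂ = c_j³·(Q₁₀ h)²·[t̄ = tip]` (`PeriodisedSymBorderWardContactTwoInstance.torus_c2_sym_weighted`),
`Q₂₂ h h * Dbar + 2 • (Q₂₁ h * Db₁) + Q₂₀ * Db₂ = Q₂₀ * Db₂′`, **`Db₂′((p̄,m), t̄) = c_j·(Σ_{b′} (Q₁₁ h)((p̄,m), b′)·h b′)·tdelta M′ (p̄ + e_m) t̄`** (the member term of `hQ₂₂` sits OUTSIDE the `−c_{j+1} •`, as in U21) —
U21's displayed `d2` (right-hand side `0`) holds iff `Q₂₀ * Db₂′ = 0`. -/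
theorem torus_d2_sym_weighted (hM' : ∀ i, Lc ∣ M' i) (j : ℕ) {κI : Type*} (pμ' : κI → ↥(pbox M')) (mμ' : κI → Fin (3 + 1))
    (h : ↥(pbox (fine Lc M')) × Fin (3 + 1) → ℝ)
    (Q₁₀ : Matrix (↥(pbox M') × Fin (3 + 1)) (↥(pbox (fine Lc M')) × Fin (3 + 1)) ℝ)
    (Q₁₁ : (↥(pbox (fine Lc M')) × Fin (3 + 1) → ℝ) → Matrix (↥(pbox M') × Fin (3 + 1)) (↥(pbox (fine Lc M')) × Fin (3 + 1)) ℝ)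
    {Q₂₀ : Matrix κI (↥(pbox M') × Fin (3 + 1)) ℝ}
    (hQ₂₀ : Q₂₀ = (perF M' (bhKStepSh 3 Lc (Dsh Lc) (j + 1))).submatrix (fun a : κI => ((pμ' a, Sum.inr (mμ' a)) : Idx M' (Fib 3)))
        (fun b : ↥(pbox M') × Fin (3 + 1) => ((b.1, Sum.inl b.2) : Idx M' (Fib 3))))
    (Q₂₁ : (↥(pbox (fine Lc M')) × Fin (3 + 1) → ℝ) → Matrix κI (↥(pbox M') × Fin (3 + 1)) ℝ)
    (hQ₂₁ : ∀ w, Q₂₁ w = ∑ b : ↥(pbox (fine Lc M')) × Fin (3 + 1), w b •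
        ∑ a' : ↥(pbox M') × Fin (3 + 1), ((stepScale 3 Lc (j + 1) / (stepScale 3 Lc j ^ 2 * ((box (3 + 1) Lc).card : ℝ))) * Q₁₀ a' b) •
          (perF M' (dper M' (symVhSAt (ctr (3 + 1) Lc) 3 Lc rfl a'.2 (a'.1 : Site (3 + 1))))).submatrix (fun a : κI => ((pμ' a, Sum.inr (mμ' a)) : Idx M' (Fib 3)))
            (fun b : ↥(pbox M') × Fin (3 + 1) => ((b.1, Sum.inl b.2) : Idx M' (Fib 3))))
    {W₂₂ : Fin (3 + 1) → Site (3 + 1) → Fin (3 + 1) → Site (3 + 1) → MKer (3 + 1) (Fib 3)}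
    (hW₂₂ : W₂₂ = fun κ' u' κ u x z a c => ∑' n : Site (3 + 1), symVh₂SAn1 3 Lc κ u κ' (translate M' u' n) x z a c)
    (Q₂₂ : (↥(pbox (fine Lc M')) × Fin (3 + 1) → ℝ) → (↥(pbox (fine Lc M')) × Fin (3 + 1) → ℝ) → Matrix κI (↥(pbox M') × Fin (3 + 1)) ℝ)
    (hQ₂₂ : ∀ w w', Q₂₂ w w' = -(((Lc : ℝ) ^ (3 + 1) * stepScale 3 Lc (j + 1))⁻¹) • (∑ a' : ↥(pbox M') × Fin (3 + 1), ∑ a'' : ↥(pbox M') × Fin (3 + 1),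
          (((stepScale 3 Lc (j + 1) / (stepScale 3 Lc j ^ 2 * ((box (3 + 1) Lc).card : ℝ))) * ∑ b : ↥(pbox (fine Lc M')) × Fin (3 + 1), Q₁₀ a' b * w b) * ((stepScale 3 Lc (j + 1) / (stepScale 3 Lc j ^ 2 * ((box (3 + 1) Lc).card : ℝ))) * ∑ b : ↥(pbox (fine Lc M')) × Fin (3 + 1), Q₁₀ a'' b * w' b)) •
            (perF M' (dper M' (W₂₂ a''.2 (a''.1 : Site (3 + 1)) a'.2 (a'.1 : Site (3 + 1))))).submatrix (fun a : κI => ((pμ' a, Sum.inr (mμ' a)) : Idx M' (Fib 3)))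
            (fun b : ↥(pbox M') × Fin (3 + 1) => ((b.1, Sum.inl b.2) : Idx M' (Fib 3))))
        + ∑ a' : ↥(pbox M') × Fin (3 + 1), ((stepScale 3 Lc (j + 1) / (stepScale 3 Lc j ^ 2 * ((box (3 + 1) Lc).card : ℝ))) * ∑ b' : ↥(pbox (fine Lc M')) × Fin (3 + 1), Q₁₁ w a' b' * w' b') •
          (perF M' (dper M' (symVhSAt (ctr (3 + 1) Lc) 3 Lc rfl a'.2 (a'.1 : Site (3 + 1))))).submatrix (fun a : κI => ((pμ' a, Sum.inr (mμ' a)) : Idx M' (Fib 3)))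
            (fun b : ↥(pbox M') × Fin (3 + 1) => ((b.1, Sum.inl b.2) : Idx M' (Fib 3))))
    {Dbar : Matrix (↥(pbox M') × Fin (3 + 1)) (Res (ctr (3 + 1) Lc) Lc M') ℝ}
    (hDbar : Dbar = Matrix.of fun (a : ↥(pbox M') × Fin (3 + 1)) (t : Res (ctr (3 + 1) Lc) Lc M') =>
        stepScale 3 Lc j * (((box (3 + 1) Lc).card : ℝ) * tgrad M' (a.1, Sum.inl a.2) t.1))
    {Db₁ : Matrix (↥(pbox M') × Fin (3 + 1)) (Res (ctr (3 + 1) Lc) Lc M') ℝ}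
    (hDb₁ : Db₁ = ∑ b : ↥(pbox (fine Lc M')) × Fin (3 + 1), h b •
        Matrix.of fun (a : ↥(pbox M') × Fin (3 + 1)) (t : Res (ctr (3 + 1) Lc) Lc M') =>
          -((((Lc : ℝ) ^ (3 + 1) * stepScale 3 Lc j)⁻¹) * Q₁₀ a b * tdelta M' ((a.1 : Site (3 + 1)) + unitVec a.2) t.1))
    {Db₂ : Matrix (↥(pbox M') × Fin (3 + 1)) (Res (ctr (3 + 1) Lc) Lc M') ℝ}
    (hDb₂ : Db₂ = Matrix.of fun (a : ↥(pbox M') × Fin (3 + 1)) (t : Res (ctr (3 + 1) Lc) Lc M') =>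
        (((Lc : ℝ) ^ (3 + 1) * stepScale 3 Lc j)⁻¹) ^ 3 * (∑ b : ↥(pbox (fine Lc M')) × Fin (3 + 1), Q₁₀ a b * h b) ^ 2 * tdelta M' ((a.1 : Site (3 + 1)) + unitVec a.2) t.1) :
    Q₂₂ h h * Dbar + (2 : ℝ) • (Q₂₁ h * Db₁) + Q₂₀ * Db₂
      = Q₂₀ * Matrix.of fun (a : ↥(pbox M') × Fin (3 + 1)) (t : Res (ctr (3 + 1) Lc) Lc M') =>
          (((Lc : ℝ) ^ (3 + 1) * stepScale 3 Lc j)⁻¹) * (∑ b' : ↥(pbox (fine Lc M')) × Fin (3 + 1), Q₁₁ h a b' * h b') * tdelta M' ((a.1 : Site (3 + 1)) + unitVec a.2) t.1 := by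
  have hcard : (box (3 + 1) Lc).card = Lc ^ (3 + 1) := by simp [AffineAveraging.box, Fintype.card_piFinset]
  have hB : ((box (3 + 1) Lc).card : ℝ) = (Lc : ℝ) ^ (3 + 1) := by rw [hcard, Nat.cast_pow]
  have hL : (Lc : ℝ) ^ (3 + 1) ≠ 0 := pow_ne_zero _ (by exact_mod_cast NeZero.ne Lc)
  have hs₀ : stepScale 3 Lc j ≠ 0 := stepScale_ne_zero (d := 3) (Lc := Lc) j
  have hs₁ : stepScale 3 Lc (j + 1) ≠ 0 := stepScale_ne_zero (d := 3) (Lc := Lc) (j + 1)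
  -- the three products, entry by entry
  have hA : Q₂₂ h h * Dbar = -(((Lc : ℝ) ^ (3 + 1) * stepScale 3 Lc (j + 1))⁻¹) • (∑ a' : ↥(pbox M') × Fin (3 + 1), ∑ a'' : ↥(pbox M') × Fin (3 + 1),
          (((stepScale 3 Lc (j + 1) / (stepScale 3 Lc j ^ 2 * ((box (3 + 1) Lc).card : ℝ))) * ∑ b : ↥(pbox (fine Lc M')) × Fin (3 + 1), Q₁₀ a' b * h b) * ((stepScale 3 Lc (j + 1) / (stepScale 3 Lc j ^ 2 * ((box (3 + 1) Lc).card : ℝ))) * ∑ b : ↥(pbox (fine Lc M')) × Fin (3 + 1), Q₁₀ a'' b * h b)) •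
            ((perF M' (dper M' (W₂₂ a''.2 (a''.1 : Site (3 + 1)) a'.2 (a'.1 : Site (3 + 1))))).submatrix (fun a : κI => ((pμ' a, Sum.inr (mμ' a)) : Idx M' (Fib 3)))
              (fun b : ↥(pbox M') × Fin (3 + 1) => ((b.1, Sum.inl b.2) : Idx M' (Fib 3))) * Dbar))
        + ∑ a' : ↥(pbox M') × Fin (3 + 1), ((stepScale 3 Lc (j + 1) / (stepScale 3 Lc j ^ 2 * ((box (3 + 1) Lc).card : ℝ))) * ∑ b' : ↥(pbox (fine Lc M')) × Fin (3 + 1), Q₁₁ h a' b' * h b') •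
          ((perF M' (dper M' (symVhSAt (ctr (3 + 1) Lc) 3 Lc rfl a'.2 (a'.1 : Site (3 + 1))))).submatrix (fun a : κI => ((pμ' a, Sum.inr (mμ' a)) : Idx M' (Fib 3)))
            (fun b : ↥(pbox M') × Fin (3 + 1) => ((b.1, Sum.inl b.2) : Idx M' (Fib 3))) * Dbar) := by
    rw [hQ₂₂ h h, Matrix.add_mul, Matrix.smul_mul, Matrix.sum_mul, Matrix.sum_mul]
    congr 1
    · refine congrArg _ (Finset.sum_congr rfl fun a' _ => ?_)
      rw [Matrix.sum_mul]
      exact Finset.sum_congr rfl fun a'' _ => Matrix.smul_mul _ _ _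
    · exact Finset.sum_congr rfl fun a' _ => Matrix.smul_mul _ _ _
  have hQ₂₁e : ∀ (α : κI) (a : ↥(pbox M') × Fin (3 + 1)), Q₂₁ h α a = ∑ b : ↥(pbox (fine Lc M')) × Fin (3 + 1), h b
      * ∑ a' : ↥(pbox M') × Fin (3 + 1), (stepScale 3 Lc (j + 1) / (stepScale 3 Lc j ^ 2 * ((box (3 + 1) Lc).card : ℝ))) * Q₁₀ a' b
        * perF M' (dper M' (symVhSAt (ctr (3 + 1) Lc) 3 Lc rfl a'.2 (a'.1 : Site (3 + 1)))) (pμ' α, Sum.inr (mμ' α)) (a.1, Sum.inl a.2) := fun α a => by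
    rw [hQ₂₁ h, Matrix.sum_apply]
    refine Finset.sum_congr rfl fun b _ => ?_
    rw [Matrix.smul_apply, Matrix.sum_apply, smul_eq_mul]
    refine congrArg _ (Finset.sum_congr rfl fun a' _ => ?_)
    rw [Matrix.smul_apply, Matrix.submatrix_apply, smul_eq_mul]
  have hDb₁e : ∀ (a : ↥(pbox M') × Fin (3 + 1)) (t : Res (ctr (3 + 1) Lc) Lc M'), Db₁ a t = ∑ b : ↥(pbox (fine Lc M')) × Fin (3 + 1), h b
      * -((((Lc : ℝ) ^ (3 + 1) * stepScale 3 Lc j)⁻¹) * Q₁₀ a b * tdelta M' ((a.1 : Site (3 + 1)) + unitVec a.2) t.1) := fun a t => by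
    rw [hDb₁, Matrix.sum_apply]
    simp only [Matrix.smul_apply, Matrix.of_apply, smul_eq_mul]
  have hBe : ∀ (α : κI) (t : Res (ctr (3 + 1) Lc) Lc M'), (Q₂₁ h * Db₁) α t = ∑ a : ↥(pbox M') × Fin (3 + 1),
      (∑ b : ↥(pbox (fine Lc M')) × Fin (3 + 1), h b * ∑ a' : ↥(pbox M') × Fin (3 + 1), (stepScale 3 Lc (j + 1) / (stepScale 3 Lc j ^ 2 * ((box (3 + 1) Lc).card : ℝ))) * Q₁₀ a' b
        * perF M' (dper M' (symVhSAt (ctr (3 + 1) Lc) 3 Lc rfl a'.2 (a'.1 : Site (3 + 1)))) (pμ' α, Sum.inr (mμ' α)) (a.1, Sum.inl a.2))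
      * (∑ b : ↥(pbox (fine Lc M')) × Fin (3 + 1), h b * -((((Lc : ℝ) ^ (3 + 1) * stepScale 3 Lc j)⁻¹) * Q₁₀ a b * tdelta M' ((a.1 : Site (3 + 1)) + unitVec a.2) t.1)) := fun α t => by
    rw [Matrix.mul_apply]
    exact Finset.sum_congr rfl fun a _ => by rw [hQ₂₁e, hDb₁e]
  have hCe : ∀ (α : κI) (t : Res (ctr (3 + 1) Lc) Lc M'), (Q₂₀ * Db₂) α t = ∑ a : ↥(pbox M') × Fin (3 + 1), Q₂₀ α a
      * ((((Lc : ℝ) ^ (3 + 1) * stepScale 3 Lc j)⁻¹) ^ 3 * (∑ b : ↥(pbox (fine Lc M')) × Fin (3 + 1), Q₁₀ a b * h b) ^ 2 * tdelta M' ((a.1 : Site (3 + 1)) + unitVec a.2) t.1) := fun α t => by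
    rw [Matrix.mul_apply]
    exact Finset.sum_congr rfl fun a _ => by rw [hDb₂, Matrix.of_apply]
  have hRe : ∀ (α : κI) (t : Res (ctr (3 + 1) Lc) Lc M'),
      (Q₂₀ * Matrix.of fun (a : ↥(pbox M') × Fin (3 + 1)) (t : Res (ctr (3 + 1) Lc) Lc M') =>
          (((Lc : ℝ) ^ (3 + 1) * stepScale 3 Lc j)⁻¹) * (∑ b' : ↥(pbox (fine Lc M')) × Fin (3 + 1), Q₁₁ h a b' * h b') * tdelta M' ((a.1 : Site (3 + 1)) + unitVec a.2) t.1) α t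
        = ∑ a : ↥(pbox M') × Fin (3 + 1), Q₂₀ α a
          * ((((Lc : ℝ) ^ (3 + 1) * stepScale 3 Lc j)⁻¹) * (∑ b' : ↥(pbox (fine Lc M')) × Fin (3 + 1), Q₁₁ h a b' * h b') * tdelta M' ((a.1 : Site (3 + 1)) + unitVec a.2) t.1) :=
    fun α t => by rw [Matrix.mul_apply]; simp only [Matrix.of_apply]
  rw [hA]
  ext α t
  rw [hRe]
  simp only [Matrix.add_apply, Matrix.smul_apply, Matrix.sum_apply, smul_eq_mul, hBe, hCe]
  rw [Finset.sum_congr rfl fun a' _ => Finset.sum_congr rfl fun a'' _ => by rw [coarse_symQ22_mul_Dbar_apply M' hM' j pμ' mμ' hW₂₂ hQ₂₀ hDbar a' a'' α t]]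
  have h1 : ∑ a' : ↥(pbox M') × Fin (3 + 1), ((stepScale 3 Lc (j + 1) / (stepScale 3 Lc j ^ 2 * ((box (3 + 1) Lc).card : ℝ))) * ∑ b' : ↥(pbox (fine Lc M')) × Fin (3 + 1), Q₁₁ h a' b' * h b')
        * ((perF M' (dper M' (symVhSAt (ctr (3 + 1) Lc) 3 Lc rfl a'.2 (a'.1 : Site (3 + 1))))).submatrix (fun a : κI => ((pμ' a, Sum.inr (mμ' a)) : Idx M' (Fib 3)))
            (fun b : ↥(pbox M') × Fin (3 + 1) => ((b.1, Sum.inl b.2) : Idx M' (Fib 3))) * Dbar) α t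
      = ∑ a' : ↥(pbox M') × Fin (3 + 1), ((stepScale 3 Lc (j + 1) / (stepScale 3 Lc j ^ 2 * ((box (3 + 1) Lc).card : ℝ))) * ∑ b' : ↥(pbox (fine Lc M')) × Fin (3 + 1), Q₁₁ h a' b' * h b')
        * (stepScale 3 Lc j * ((box (3 + 1) Lc).card : ℝ)
          * (tdelta M' ((a'.1 : Site (3 + 1)) + unitVec a'.2) t.1 * ((((Lc : ℝ) ^ (3 + 1) * stepScale 3 Lc (j + 1))⁻¹) * Q₂₀ α a'))) :=
    Finset.sum_congr rfl fun a' _ => by rw [coarse_symVhSAt_mul_Dbar_apply M' hM' j pμ' mμ' hQ₂₀ hDbar a' α t]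
  rw [h1]
  exact d2_entry_algebra h (fun a b => Q₁₀ a b) (fun a b' => Q₁₁ h a b')
    (fun a' a => perF M' (dper M' (symVhSAt (ctr (3 + 1) Lc) 3 Lc rfl a'.2 (a'.1 : Site (3 + 1)))) (pμ' α, Sum.inr (mμ' α)) (a.1, Sum.inl a.2))
    (fun a => Q₂₀ α a) (fun a => tdelta M' ((a.1 : Site (3 + 1)) + unitVec a.2) t.1) hs₀ hs₁ hL hB

end Summit.QuantumFields.BalabanUV.Beta.FP.PeriodisedSymCoarseWardContactTwo

end
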